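import Literature.Probability.Percolation.StarWinding
import Literature.Probability.Percolation.SemicircuitDomain
import HarnessLib

/-!
# Winding types of good paths "above" and "below" a box (GH2000, Lemma 5.5, last step)

Topic `Probability/Percolation`. Georgii–Higuchi 2000 conclude the proof of Lemma 5.5 (p. 16) with
"if `A_{x,y} ∩ B_{x,y}` occurs then `Δ` is surrounded by a `≤∗`circuit". The paths "above `Δ`"
produced by the pinning lemma live in reflection-symmetric stopping domains and may dip below the
axis ("tongues"); what makes the union of a path above and a path below surround `Δ = Λ_m` is a
winding condition, formalised here with the winding number `starWinding` of `StarWinding.lean`: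

* `UpperType m W`: `W` avoids `Λ_m`, winds `-1` times around the axis points `(c, 0)`, `|c| ≤ m`,
  and `0` times around the points `(c, -1)`; `LowerType m W`: values `0` and `1`;
* **`exists_mem_support_of_types`** — if `W_A` is of upper type and `W_B` of lower type (same
  endpoints, inside `Λ_H`) then every lattice walk from `Λ_m` to the outside of `Λ_H` meets
  `W_A ∪ W_B` (winding `-1 ≠ 0` of the closed walk `W_A W_B⁻¹`, constancy along lattice walks);
* **`upperType_append`** — the producer: `P_x · M · P_y⁻¹` is of upper type when `P_x` (from `x` on
  the left) avoids `Λ_m` and meets the axis only left of `-m` (tongues below the axis allowed), `M`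
  lies in the closed upper half-plane off `Λ_m`, and `P_y` (from `y` on the right) avoids `Λ_m` and
  meets the axis only right of `m` — three telescoping computations;
* **`lowerType_map_reflect`** — the reflection `x₂ ↦ -x₂` maps upper type to lower type
  (`starWinding (R W) (c,0) = -starWinding W (c,-1)` for walks avoiding `Λ_m`).

## References

* H.-O. Georgii, Y. Higuchi, J. Math. Phys. 41 (2000), proof of Lemma 5.5 (p. 16) [GeorgiiHiguchi2000].
* H. Kesten, *Percolation theory for mathematicians* (1982), §2.2 [Kesten1982].
-/

noncomputable section

open SimpleGraph
open Literature.Probability.LatticeModels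

namespace Literature.Probability.Percolation

/-! ### Points and elementary facts -/

/-- The site `(a, b)`. [folklore] -/
def mkSite (a b : ℤ) : Site 2 := fun i => if i = 0 then a else b

/-- Coordinates of `mkSite`. [folklore] -/
@[simp] theorem mkSite_apply_zero (a b : ℤ) : mkSite a b 0 = a := rfl

/-- Coordinates of `mkSite`. [folklore] -/
@[simp] theorem mkSite_apply_one (a b : ℤ) : mkSite a b 1 = b := rfl

/-- A site outside `Λ_m` is not one of the points `(c, r)` with `|c|, |r| ≤ m`. [folklore] -/
theorem ne_coords_of_not_mem_box {m : ℕ} {z : Site 2} (hz : z ∉ box 2 m) {c r : ℤ}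
    (hc : -(m : ℤ) ≤ c ∧ c ≤ m) (hr : -(m : ℤ) ≤ r ∧ r ≤ m) : ¬ (z 0 = c ∧ z 1 = r) := by
  rintro ⟨h0, h1⟩
  exact hz (mem_box.2 fun i => by fin_cases i <;> simp <;> omega)

/-- Coordinates of `∗`-neighbours differ by at most one. [folklore] -/
theorem abs_sub_le_of_dart {a b : Site 2} (_p : zdStarGraph.Walk a b) {d : zdStarGraph.Dart} (_hd : d ∈ _p.darts) :
    (-1 ≤ d.fst 0 - d.snd 0 ∧ d.fst 0 - d.snd 0 ≤ 1) ∧ (-1 ≤ d.fst 1 - d.snd 1 ∧ d.fst 1 - d.snd 1 ≤ 1) := by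
  have hadj := d.adj
  rw [zdStarGraph_adj] at hadj
  have h0 := hadj.2 0; have h1 := hadj.2 1
  rw [abs_le] at h0 h1
  exact ⟨h0, h1⟩

/-! ### The two winding types -/

/-- **Upper type**: a `∗`-walk avoiding `Λ_m` with winding `-1` around the axis points `(c, 0)`,
`|c| ≤ m`, and `0` around the points `(c, -1)` (the type of a good path "above `Δ`"). [cite: GeorgiiHiguchi2000, Lemma 5.5 (proof, p. 16)] -/
def UpperType (m : ℕ) {x y : Site 2} (W : zdStarGraph.Walk x y) : Prop :=
  (∀ z ∈ W.support, z ∉ box 2 m) ∧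
    ∀ c : ℤ, -(m : ℤ) ≤ c → c ≤ m → starWinding W (mkSite c 0) = -1 ∧ starWinding W (mkSite c (-1)) = 0

/-- **Lower type**: winding `0` around `(c, 0)` and `1` around `(c, -1)` (a good path "below `Δ`"). [cite: GeorgiiHiguchi2000, Lemma 5.5 (proof, p. 16)] -/
def LowerType (m : ℕ) {x y : Site 2} (W : zdStarGraph.Walk x y) : Prop :=
  (∀ z ∈ W.support, z ∉ box 2 m) ∧
    ∀ c : ℤ, -(m : ℤ) ≤ c → c ≤ m → starWinding W (mkSite c 0) = 0 ∧ starWinding W (mkSite c (-1)) = 1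

/-! ### Enclosure -/

/-- **A pair of walks of upper and lower type surrounds `Λ_m`**: every lattice walk from `Λ_m` to
the outside of a box `Λ_H` containing both walks meets one of them ("`Δ` is surrounded by a
`≤∗`circuit"). [cite: GeorgiiHiguchi2000, Lemma 5.5 (proof, p. 16)] -/
theorem exists_mem_support_of_types {m H : ℕ} {x y : Site 2} (WA WB : zdStarGraph.Walk x y)
    (hA : UpperType m WA) (hB : LowerType m WB)
    (hHA : ∀ z ∈ WA.support, z ∈ box 2 H) (hHB : ∀ z ∈ WB.support, z ∈ box 2 H)
    {t w : Site 2} (ht : t ∈ box 2 m) (hw : w ∉ box 2 H) (β : (zdGraph 2).Walk t w) :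
    ∃ z ∈ β.support, z ∈ WA.support ∨ z ∈ WB.support := by
  by_contra hdis
  push Not at hdis
  set C := WA.append WB.reverse with hC
  have hCsupp : ∀ z, z ∈ C.support ↔ z ∈ WA.support ∨ z ∈ WB.support := fun z => by
    rw [hC, Walk.mem_support_append_iff, Walk.support_reverse, List.mem_reverse]
  have hCbox : ∀ z ∈ C.support, z ∉ box 2 m := fun z hz => by
    rcases (hCsupp z).1 hz with h | h
    · exact hA.1 z h
    · exact hB.1 z h
  have hw0 : starWinding C w = 0 :=
    starWinding_eq_zero_of_not_mem_box C (fun z hz => by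
      rcases (hCsupp z).1 hz with h | h
      · exact hHA z h
      · exact hHB z h) hw
  have hconst : starWinding C t = starWinding C w :=
    starWinding_eq_of_latticeWalk C β (fun z hz h => by
      rcases (hCsupp z).1 h with h' | h'
      · exact (hdis z hz).1 h'
      · exact (hdis z hz).2 h') (fun _ _ _ _ _ => Iff.rfl)
  -- move the base point vertically inside `Λ_m` to the axis
  have htm := mem_box.1 ht
  set t₀ := mkSite (t 0) 0 with ht₀
  have hvert : ∀ (z : Site 2) (k : ℕ), z 0 = t 0 → -(m : ℤ) ≤ z 1 - k → z 1 ≤ m →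
      starWinding C z = starWinding C ((fun w : Site 2 => w - Pi.single 1 1)^[k] z) := by
    intro z k hz0 hzk hz1
    refine starWinding_eq_of_latticeWalk C (downRun z k) (fun v hv hvC => hCbox v hvC ?_) (fun _ _ _ _ _ => Iff.rfl)
    rw [mem_support_downRun] at hv
    have h0 := (htm 0)
    exact mem_box.2 fun i => by fin_cases i <;> simp <;> omega
  have hCt₀ : starWinding C t = starWinding C t₀ := by
    rcases le_or_gt 0 (t 1) with h1 | h1
    · obtain ⟨k, hk⟩ : ∃ k : ℕ, t 1 = k := ⟨(t 1).toNat, by omega⟩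
      have hend : (fun w : Site 2 => w - Pi.single 1 1)^[k] t = t₀ := by
        rw [iterate_sub_single_one]; ext i; fin_cases i <;> simp [ht₀, hk]
      rw [← hend]
      exact hvert t k rfl (by have := (htm 1).1; omega) (htm 1).2
    · obtain ⟨k, hk⟩ : ∃ k : ℕ, t 1 = -k := ⟨(-t 1).toNat, by omega⟩
      have hend : (fun w : Site 2 => w - Pi.single 1 1)^[k] t₀ = t := by
        rw [iterate_sub_single_one]; ext i; fin_cases i <;> simp [ht₀, hk]
      have := hvert t₀ k (by simp [ht₀]) (by have := (htm 1).1; simp [ht₀]; omega) (by simp [ht₀])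
      rw [hend] at this
      exact this.symm
  have hc : -(m : ℤ) ≤ t 0 ∧ t 0 ≤ m := htm 0
  have hAt := (hA.2 (t 0) hc.1 hc.2).1
  have hBt := (hB.2 (t 0) hc.1 hc.2).1
  have : starWinding C t₀ = -1 := by
    rw [hC, starWinding_append, starWinding_reverse, hAt, hBt]; ring
  rw [hCt₀, this] at hconst
  rw [← hconst] at hw0
  exact absurd hw0 (by norm_num)

/-! ### The producer: telescoping computations -/

section Producer

variable {a b : Site 2}

/-- A walk meeting the axis only at columns `< -m` has no winding around `(c, 0)` and `(c, -1)`
for `c ≥ -m` (every step has zero step winding). [folklore] -/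
theorem starWinding_eq_zero_of_axis_lt {m : ℕ} (P : zdStarGraph.Walk a b)
    (hP : ∀ z ∈ P.support, z 1 = 0 → z 0 < -(m : ℤ)) {c : ℤ} (hc : -(m : ℤ) ≤ c) :
    starWinding P (mkSite c 0) = 0 ∧ starWinding P (mkSite c (-1)) = 0 := by
  induction P with
  | nil => exact ⟨rfl, rfl⟩
  | cons h p ih =>
    rename_i u v w
    have ih' := ih fun z hz => hP z (by simp [hz])
    have hu := hP u (by simp); have hv := hP v (by simp)
    rw [zdStarGraph_adj] at h
    have h0 := h.2 0
    rw [abs_le] at h0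
    rw [starWinding_cons, starWinding_cons, ih'.1, ih'.2, add_zero, add_zero]
    unfold starStepWinding starUpStep
    simp only [mkSite_apply_zero, mkSite_apply_one]
    constructor <;> split_ifs <;> omega

/-- The potential for the upper telescoping: `-1` on the axis right of `c`. [folklore] -/
def gAxis (c : ℤ) (z : Site 2) : ℤ := if z 1 = 0 ∧ c + 1 ≤ z 0 then -1 else 0

/-- **Upper telescoping**: a walk in the closed upper half-plane avoiding the point `(c, 0)` winds
`gAxis c b - gAxis c a` around `(c, 0)` (cf. `starWinding_upper_axis`). [folklore] -/
theorem starWinding_upper_telescope (M : zdStarGraph.Walk a b) {c : ℤ}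
    (hM : ∀ z ∈ M.support, 0 ≤ z 1 ∧ ¬ (z 0 = c ∧ z 1 = 0)) :
    starWinding M (mkSite c 0) = gAxis c b - gAxis c a := by
  refine starWinding_eq_of_telescope M (mkSite c 0) (gAxis c) fun d hd => ?_
  have hx := hM d.fst (Walk.dart_fst_mem_support_of_mem_darts M hd)
  have hy := hM d.snd (Walk.dart_snd_mem_support_of_mem_darts M hd)
  obtain ⟨h0, h1⟩ := abs_sub_le_of_dart M hd
  unfold starStepWinding starUpStep gAxis
  simp only [mkSite_apply_zero, mkSite_apply_one]
  split_ifs <;> omega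

/-- A walk in the closed upper half-plane does not wind around `(c, -1)`. [folklore] -/
theorem starWinding_upper_below (M : zdStarGraph.Walk a b) {c : ℤ} (hM : ∀ z ∈ M.support, 0 ≤ z 1) :
    starWinding M (mkSite c (-1)) = 0 :=
  starWinding_eq_zero_of_ge M (L := 0) hM (by simp)

/-- The potentials for the right-hand telescoping. [folklore] -/
def hUp (z : Site 2) : ℤ := if 1 ≤ z 1 then 1 else 0

/-- The potentials for the right-hand telescoping. [folklore] -/
def hDown (z : Site 2) : ℤ := if z 1 ≤ -1 then -1 else 0

/-- **Right-hand telescoping**: a walk avoiding `Λ_m` (`m ≥ 1`) and meeting the axis only at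
columns `> m` winds `hUp b - hUp a` around `(c, 0)` and `hDown b - hDown a` around `(c, -1)`,
`|c| ≤ m`. [folklore] -/
theorem starWinding_right_telescope {m : ℕ} (hm : 1 ≤ m) (P : zdStarGraph.Walk a b)
    (hP : ∀ z ∈ P.support, (z 1 = 0 → (m : ℤ) < z 0) ∧ z ∉ box 2 m) {c : ℤ} (hc : -(m : ℤ) ≤ c ∧ c ≤ m) :
    starWinding P (mkSite c 0) = hUp b - hUp a ∧ starWinding P (mkSite c (-1)) = hDown b - hDown a := by
  constructor
  · refine starWinding_eq_of_telescope P (mkSite c 0) hUp fun d hd => ?_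
    have hx := hP d.fst (Walk.dart_fst_mem_support_of_mem_darts P hd)
    have hy := hP d.snd (Walk.dart_snd_mem_support_of_mem_darts P hd)
    obtain ⟨h0, h1⟩ := abs_sub_le_of_dart P hd
    have hx1 := hx.1; have hy1 := hy.1
    unfold starStepWinding starUpStep hUp
    simp only [mkSite_apply_zero, mkSite_apply_one]
    split_ifs <;> omega
  · refine starWinding_eq_of_telescope P (mkSite c (-1)) hDown fun d hd => ?_
    have hx := hP d.fst (Walk.dart_fst_mem_support_of_mem_darts P hd)
    have hy := hP d.snd (Walk.dart_snd_mem_support_of_mem_darts P hd)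
    obtain ⟨h0, h1⟩ := abs_sub_le_of_dart P hd
    have hx1 := hx.1; have hy1 := hy.1
    have hxm : ¬ (d.fst 0 = m ∧ d.fst 1 = -1) := ne_coords_of_not_mem_box hx.2 ⟨by omega, le_rfl⟩ ⟨by omega, by omega⟩
    have hym : ¬ (d.snd 0 = m ∧ d.snd 1 = -1) := ne_coords_of_not_mem_box hy.2 ⟨by omega, le_rfl⟩ ⟨by omega, by omega⟩
    unfold starStepWinding starUpStep hDown
    simp only [mkSite_apply_zero, mkSite_apply_one]
    split_ifs <;> omega

/-- **The producer.** `W = P_x · M · P_y⁻¹` is of upper type when: `P_x` (from `x`) avoids `Λ_m` and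
meets the axis only at columns `< -m`; `M` lies in the closed upper half-plane off `Λ_m`; `P_y`
(from `y`, `y₂ = 0`) avoids `Λ_m` and meets the axis only at columns `> m`; `m ≥ 1`. [cite: GeorgiiHiguchi2000, Lemma 5.5 (proof, p. 16)] -/
theorem upperType_append {m : ℕ} (hm : 1 ≤ m) {x a' b' y : Site 2}
    (Px : zdStarGraph.Walk x a') (M : zdStarGraph.Walk a' b') (Py : zdStarGraph.Walk y b')
    (hPx : ∀ z ∈ Px.support, z ∉ box 2 m ∧ (z 1 = 0 → z 0 < -(m : ℤ)))
    (hMu : ∀ z ∈ M.support, 0 ≤ z 1 ∧ z ∉ box 2 m)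
    (hPy : ∀ z ∈ Py.support, z ∉ box 2 m ∧ (z 1 = 0 → (m : ℤ) < z 0)) (hy : y 1 = 0) :
    UpperType m (Px.append (M.append Py.reverse)) := by
  refine ⟨fun z hz => ?_, fun c hc1 hc2 => ?_⟩
  · rw [Walk.mem_support_append_iff, Walk.mem_support_append_iff, Walk.support_reverse, List.mem_reverse] at hz
    rcases hz with hz | hz | hz
    · exact (hPx z hz).1
    · exact (hMu z hz).2
    · exact (hPy z hz).1
  have hPx0 := starWinding_eq_zero_of_axis_lt Px (fun z hz => (hPx z hz).2) hc1
  have hM0 : starWinding M (mkSite c 0) = gAxis c b' - gAxis c a' :=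
    starWinding_upper_telescope M fun z hz => ⟨(hMu z hz).1,
      ne_coords_of_not_mem_box (hMu z hz).2 ⟨hc1, hc2⟩ ⟨by omega, by omega⟩⟩
  have hM1 : starWinding M (mkSite c (-1)) = 0 := starWinding_upper_below M fun z hz => (hMu z hz).1
  have hPy' := starWinding_right_telescope hm Py (fun z hz => ⟨(hPy z hz).2, (hPy z hz).1⟩) ⟨hc1, hc2⟩
  -- endpoint values
  have ha' : gAxis c a' = 0 := by
    have h := (hPx a' (Walk.end_mem_support Px)).2
    unfold gAxis; split_ifs with h' <;> [exact absurd (h h'.1) (by omega); rfl]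
  have hb'1 : 0 ≤ b' 1 := (hMu b' (Walk.end_mem_support M)).1
  have hb'ax := (hPy b' (Walk.end_mem_support Py)).2
  have hyU : hUp y = 0 := by unfold hUp; rw [if_neg (by omega)]
  have hyD : hDown y = 0 := by unfold hDown; rw [if_neg (by omega)]
  rw [starWinding_append, starWinding_append, starWinding_reverse, starWinding_append, starWinding_append,
    starWinding_reverse, hPx0.1, hPx0.2, hM0, hM1, hPy'.1, hPy'.2, ha', hyU, hyD]
  refine ⟨?_, ?_⟩
  · unfold gAxis hUp
    by_cases hb0 : b' 1 = 0
    · rw [if_pos ⟨hb0, by have := hb'ax hb0; omega⟩, if_neg (by omega)]; ring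
    · rw [if_neg (fun h => hb0 h.1), if_pos (by omega)]; ring
  · unfold hDown; rw [if_neg (by omega)]; ring

end Producer

/-! ### Reflection exchanges the types -/

section Reflect

/-- Step windings of a reflected step (base point `(c,0)`) versus the original step (base point
`(c,-1)`), for steps avoiding `(c, 0)` and `(c, -1)`. [folklore] -/
theorem starStepWinding_reflect_zero {c : ℤ} {u v : Site 2} (huv : zdStarGraph.Adj u v)
    (hu0 : ¬ (u 0 = c ∧ u 1 = 0)) (hv0 : ¬ (v 0 = c ∧ v 1 = 0)) (hu1 : ¬ (u 0 = c ∧ u 1 = -1)) (hv1 : ¬ (v 0 = c ∧ v 1 = -1)) :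
    starStepWinding (mkSite c 0) (Rf u) (Rf v) = -starStepWinding (mkSite c (-1)) u v := by
  rw [zdStarGraph_adj] at huv
  have h0 := huv.2 0; have h1 := huv.2 1
  rw [abs_le] at h0 h1
  unfold starStepWinding starUpStep
  simp only [mkSite_apply_zero, mkSite_apply_one, Rf_apply_zero, Rf_apply_one]
  split_ifs <;> omega

/-- Step windings of a reflected step (base point `(c,-1)`) versus the original step (base point
`(c,0)`), for steps avoiding `(c, 0)` and `(c, 1)`. [folklore] -/
theorem starStepWinding_reflect_neg_one {c : ℤ} {u v : Site 2} (huv : zdStarGraph.Adj u v)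
    (hu0 : ¬ (u 0 = c ∧ u 1 = 0)) (hv0 : ¬ (v 0 = c ∧ v 1 = 0)) (hu1 : ¬ (u 0 = c ∧ u 1 = 1)) (hv1 : ¬ (v 0 = c ∧ v 1 = 1)) :
    starStepWinding (mkSite c (-1)) (Rf u) (Rf v) = -starStepWinding (mkSite c 0) u v := by
  rw [zdStarGraph_adj] at huv
  have h0 := huv.2 0; have h1 := huv.2 1
  rw [abs_le] at h0 h1
  unfold starStepWinding starUpStep
  simp only [mkSite_apply_zero, mkSite_apply_one, Rf_apply_zero, Rf_apply_one]
  split_ifs <;> omega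

/-- **Winding of the reflected walk** (walks avoiding `Λ_m`, `m ≥ 1`, `|c| ≤ m`). [folklore] -/
theorem starWinding_map_reflect {m : ℕ} (hm : 1 ≤ m) {x y : Site 2} (W : zdStarGraph.Walk x y)
    (hW : ∀ z ∈ W.support, z ∉ box 2 m) {c : ℤ} (hc : -(m : ℤ) ≤ c ∧ c ≤ m) :
    starWinding (W.map (starReflectHom 1)) (mkSite c 0) = -starWinding W (mkSite c (-1)) ∧
      starWinding (W.map (starReflectHom 1)) (mkSite c (-1)) = -starWinding W (mkSite c 0) := by
  induction W with
  | nil => simp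
  | cons h p ih =>
    rename_i u v w
    have ih' := ih fun z hz => hW z (by simp [hz])
    have hu := hW u (by simp); have hv := hW v (by simp)
    have nb : ∀ {z : Site 2}, z ∉ box 2 m → ∀ r : ℤ, -(m : ℤ) ≤ r → r ≤ m → ¬ (z 0 = c ∧ z 1 = r) :=
      fun hz r hr1 hr2 => ne_coords_of_not_mem_box hz hc ⟨hr1, hr2⟩
    rw [Walk.map_cons, starWinding_cons, starWinding_cons, starWinding_cons, starWinding_cons, ih'.1, ih'.2]
    change starStepWinding (mkSite c 0) (Rf u) (Rf v) + _ = _ ∧ starStepWinding (mkSite c (-1)) (Rf u) (Rf v) + _ = _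
    rw [starStepWinding_reflect_zero h (nb hu 0 (by omega) (by omega)) (nb hv 0 (by omega) (by omega))
        (nb hu (-1) (by omega) (by omega)) (nb hv (-1) (by omega) (by omega)),
      starStepWinding_reflect_neg_one h (nb hu 0 (by omega) (by omega)) (nb hv 0 (by omega) (by omega))
        (nb hu 1 (by omega) (by omega)) (nb hv 1 (by omega) (by omega))]
    constructor <;> ring

/-- The reflection preserves `Λ_m`-avoidance. [folklore] -/
theorem not_mem_box_Rf {m : ℕ} {z : Site 2} (hz : z ∉ box 2 m) : Rf z ∉ box 2 m := by
  intro h; apply hz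
  rw [mem_box] at h ⊢
  intro i; have h0 := h 0; have h1 := h 1
  rw [Rf_apply_zero] at h0; rw [Rf_apply_one] at h1
  fin_cases i <;> simp <;> omega

/-- **Reflection maps upper type to lower type.** [cite: GeorgiiHiguchi2000, Lemma 5.5 (proof: "its analogue for the lower half-plane")] -/
theorem lowerType_map_reflect {m : ℕ} (hm : 1 ≤ m) {x y : Site 2} {W : zdStarGraph.Walk x y} (hW : UpperType m W) :
    LowerType m (W.map (starReflectHom 1)) := by
  refine ⟨fun z hz => ?_, fun c hc1 hc2 => ?_⟩
  · obtain ⟨w, hw, rfl⟩ := mem_support_map_starReflect W z hz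
    exact not_mem_box_Rf (hW.1 w hw)
  · have h := starWinding_map_reflect hm W hW.1 ⟨hc1, hc2⟩
    have h' := hW.2 c hc1 hc2
    rw [h.1, h.2, h'.1, h'.2]; norm_num

/-- **Reflection maps lower type to upper type.** [folklore] -/
theorem upperType_map_reflect {m : ℕ} (hm : 1 ≤ m) {x y : Site 2} {W : zdStarGraph.Walk x y} (hW : LowerType m W) :
    UpperType m (W.map (starReflectHom 1)) := by
  refine ⟨fun z hz => ?_, fun c hc1 hc2 => ?_⟩
  · obtain ⟨w, hw, rfl⟩ := mem_support_map_starReflect W z hz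
    exact not_mem_box_Rf (hW.1 w hw)
  · have h := starWinding_map_reflect hm W hW.1 ⟨hc1, hc2⟩
    have h' := hW.2 c hc1 hc2
    rw [h.1, h.2, h'.1, h'.2]; norm_num

end Reflect

end Literature.Probability.Percolation
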